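import Literature.AlgebraicGeometry.AbelianSchemes.AbelianSchemeDualPair
import Literature.AlgebraicGeometry.AbelianSchemes.AbelianSchemeKOfLEtaleOfConstantRank
import Literature.AlgebraicGeometry.AbelianSchemes.AbelianSchemeKOfLFlat   -- ★ p789144 (K) closer `AbelianSchemeOver.exists_kOfL_etale` (B-p08 (g15)); ed. 1.3
import Literature.AlgebraicGeometry.AbelianSchemes.ProjectiveAbelianSchemeAmpleClass   -- ★ p788891 (L) closer `AbelianSchemeOver.exists_affine_rigidified_fibrewise_ample_of_isProjective` (B-p12 (g18)); ed. 1.4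
import Summits.HodgeConjecture.HodgeConjecture.Theorems.F3DualAbelianSchemeStubZ   -- ★ p797538 (Z) closer `stub_F3Z_holds` (F0P1c-p04 (g0)); ed. 1.5
import Summits.HodgeConjecture.HodgeConjecture.Theorems.F3DualAbelianSchemeStubM   -- ★ p797770 (M) closer `stub_F3M_holds` (T3; bytes B-p10 (g14), filer B-p11 (g21)); ed. 1.6
import Literature.AlgebraicGeometry.Morphisms.ProjectiveMorphism
import Literature.AlgebraicGeometry.Morphisms.ProjectiveMorphismComposition
import HarnessLib

/-!
# F-3 sub-line `F0/P1/Lines/F3DualAbelianScheme` — SKELETON v1, ed. 1.3 (B-plan1 (g19) pen, 2026-08-30; over B-typ01 (g17) menu v0 7057b60d)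

Ed. 1.3 (21:10Z, director s339, over ed. 1.2 = tree 9f45cbe0): stub (K) `stub_F3K` is DISCHARGED BY NAME — its `sorry` becomes
`A.exists_kOfL_etale hL hε hΘ` (★ p789144 `AbelianSchemes/AbelianSchemeKOfLFlat`, B-p08 (g15); road T = ★ p787357 · p788917 · p787638 · p788430 · p789144)
plus the one import; every letter (statement text) and every other byte is identical to ed. 1.2.  Open stubs: (Z) (L) (M).

Ed. 1.5 (2026-08-31, over ed. 1.4 = tree 7200c2d9): stub (Z) `stub_F3Z` is DISCHARGED BY NAME — its `sorry` becomes
`Theorems.F3DualAbelianScheme.stub_F3Z_holds` (★ p797538 `Summits/…/Theorems/F3DualAbelianSchemeStubZ`, F0P1c-p04 (g0); road (Z) = ★ p794371 FILE H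
part 1 · ★ p795023 part 2b `exists_gluedHat` (B-p18 (g21)) · ★ p794425 · ★ p795075 · ★ p796588 / p796592 / p796818 / p796835 / p797208 P-b chain ·
★ p797369 P-a assembly (B-p06 (g14) over ★ B-p15 (g15) `Modules/RigidifiedZariskiGluing`) · ★ p796564 chart compatibility `hcompat`) plus the one
import; every letter (statement text) and every other byte is identical to ed. 1.4.  Open stubs: (M) only ((Z) (L) (K) are theorems).

Ed. 1.6 (2026-08-31, B-p11 (g21) (M) pen, over ed. 1.5 = tree 385dca64): stub (M) `stub_F3M` is DISCHARGED BY NAME — its `sorry` becomes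
`Theorems.F3DualAbelianScheme.stub_F3M_holds` (★ p797770 `Summits/…/Theorems/F3DualAbelianSchemeStubM` = rung T3: the (M) child line
`Lines/F3DualAbelianSchemeM.lean` (ed. 7, sorry-free) re-homed — (Ma) ★ p795118 · (Mb) ★ p792832 · (Mc) ★ p797599 (T2, over T1 ★ p796744/p797055)
· (Md1)(Md2)(Md3) ★ E6/E4/E3) plus the one import; every letter (statement text) and every other byte is identical to ed. 1.5.
Open stubs: NONE — THE F-3 SUB-LINE IS SORRY-FREE; `#print axioms stub_F3` = [propext, Classical.choice, Quot.sound]; the registry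
letter `stub_F3` of 24835 closes by T4 `Theorems/…` (F0P1c-p06 (g2)) / the Q-F3 registry fold (B-plan1 (g20)).

Ed. 1.1 (19:35Z, over ed. 1 = tree 17224f58): `stub_F3M` gains the binder `(_hA : IsProjective A.X.hom)` (B-p16 (g18) letter check
19:29Z: Mumford's `Â := A'⁄K'` via ★ `quotientBy` needs «finite sets of points in an affine open» of `A'`, i.e. (quasi-)projectivity over
the affine base, which fibrewise ampleness `_hΘ` alone does not give without EGA IV 9.6.4 (∅ in the tree)); §5 threads it from its own `hA`
by ★ `IsProjective.pullback_snd`; the letters `stub_F3Z` / `stub_F3L` / `stub_F3K`, §6 and the HEAD are byte-identical to ed. 1.  The (M) child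
line `Lines/F3DualAbelianSchemeM.lean` restates the new :151 letter as its head (child ed. 3).
Ed. 1.2 (19:45Z): CONNECTEDNESS OF THE AFFINE BASE (B-p19 (g18) referee pass 19:34Z: over a DISCONNECTED `Spec R` with non-constant
`#K(L_s̄)` — witness `R = ℚ × ℚ`, `A = E ⊔ E`, `L = 𝒪(0) ⊔ 𝒪(3·0)`, all hypotheses of (M) hold — Mumford's `A'⁄K'` has no single finite
constant `K'` acting freely; the construction runs per connected component).  `stub_F3L`'s OUTPUT gains the conjunct
`ConnectedSpace ↥(Spec (.of R))` (the chart at `s` shrunk to the clopen connected component of `s` in a Noetherian affine open, which is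
again affine), `stub_F3M` gains the binder `[ConnectedSpace ↥(Spec (.of R))]`, §5 threads it; `stub_F3Z` / `stub_F3K`, §6 and the HEAD are
unchanged in statement.  The (M) child line restates the new (M) letter as its head (child ed. 4).

HC_CM is proved only modulo the 7 printed citations until rung 0 closes; nothing in this file is about HC.

HEAD = the registry-24835 (v5.5-C) letter `stub_F3` VERBATIM (REF1 digest 343c289e; = binder `hF3` of ★
`exists_threshold_siegelFineModuliScheme_of_cores'`, consumed by the P1 head file `F0/P1/Lines/SiegelModuliExists.lean`):
«over a locally noetherian `ℚ`-scheme `S`, an abelian scheme `A → S` that is Zariski-locally on `S` a base change of a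
PROJECTIVE abelian scheme has a ★ `DualPair`» — [MumfordFogartyKirwan1994, Ch. 6 §1 Cor. 6.8 (p. 118)] + §2 (p. 121) in the
tree's `DualPair` format (Milne's universal pair over ALL `T → S`, rigidified, fibrewise `Pic⁰`).  It is PROVED here (kernel-checked)
from FOUR registered stubs, each a genuine lemma of a different technique class, along MUMFORD'S ROAD «`Â := A ⁄ K(L)`»
([MumfordAV1970] §§8, 10–13) = price-sheet road (Q) (B-p14 (g19) `F-DAG-PRICE.v3.0` §3 F-3; re-priced 16–22 files for exactly the six
`DualPair` fields, B-p12 (g16) census bd19d2f3) — the road the tree is deepest in (★ `AbelianSchemeKOfL*` ×12, ★ `AbelianSchemeOver.quotientBy`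
+ `AbelianSchemeConstSubgroupQuotient*` ×10, ★ `AbelianSchemeQuotientPoincare*` ×8, ★ `DualPairBaseQuotientDescent*` / `PoincareBaseQuotientDescent*`,
★ `RigidifiedTrivialFpqcDescent*`), NOT Grothendieck's road (P) «`Pic_{A/S}` via the Hilbert scheme of divisors» (blocked on F-5, ≥ 25 files):

* §1 `stub_F3Z` (Z) — dual pairs GLUE along an open cover of the base (B-p06 (g14) census 4119b73a §0 letter, B-typ01 menu §2
  verbatim; road (Z1)(Z2)(Z3), 3 files).  Technique: Zariski gluing of `S`-objects from a cocycle made canonical by `DualPair.universal`.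
* §2 `stub_F3L` (L) — PROJECTIVE ⇒ affine-locally on `S` a rank-one `L` on `A`, rigidified along `ε`, fibrewise of the class of an
  AMPLE divisor (the exact `(hL, hε, hΘ)` currency of ★ `exists_isClosedImmersion_isFinite_iff_memKOfL_of_isNoetherianRing`): `L := 𝒪(1)|_A ⊗
  (π^* ε^* 𝒪(1)|_A)⁻¹` on a chart trivialising `ε^*𝒪(1)`, `Θ_s̄ :=` a hyperplane section of the fibre.  Technique: projective geometry (S–M, 1–2 files).
* §3 `stub_F3K` (K) — over a Noetherian affine `ℚ`-base, `K(L)` of such an `L` is (represented by) a closed subgroup scheme FINITE ÉTALE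
  over the base ([MumfordAV1970] §13; étale = ★ `exists_kOfL_etale_of_finrank_fibre_eq` (integral base, given constancy of the fibre rank)
  + the constancy `|K(L_s̄)| = χ(L_s̄)²` ([MumfordAV1970] §16 Riemann–Roch) on connected components + over NON-reduced bases the
  infinitesimal lifting of points of `K(L)` (`dφ_L` is an isomorphism in characteristic 0)).  Technique: numerics + deformation (M–L, 2–4 files).
* §4 `stub_F3M` (M) — **THE HARDEST STUB**: MUMFORD'S CONSTRUCTION over a Noetherian affine `ℚ`-base: from `(A, L)` as in (L) and
  `K(L)` finite étale as in (K), `A` HAS A DUAL PAIR — `Â := A ⁄ K(L)` (étale-locally on the base `K(L)` is constant and ★ `quotientBy`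
  applies), `𝒫 :=` the descent of the Mumford bundle `Λ(L) = m^*L ⊗ p₁^*L⁻¹ ⊗ p₂^*L⁻¹` (★ `AbelianSchemeOver.mumfordBundle`) along `1 × π`
  ([MumfordAV1970] §13 p. 125), `hasRank_one`/`rigid` by construction, `fibrewisePicZero` ([MumfordAV1970] §8), UNIVERSALITY over ALL
  `T → Spec R` (Artinian lifting lemma + seesaw transporter + ★ `RigidifiedTrivialFpqcDescent`; [MumfordAV1970] §13 Theorem p. 125,
  [MumfordFogartyKirwan1994] Ch. 6 §2 p. 121), then Galois base-quotient descent of the étale-local dual pair (★ `DualPairBaseQuotientDescent.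
  exists_dualPair_fields_of_free_base_quotient` with its `IsReduced` hypothesis removed) and (Z).  Technique: quotients + descent (L–XL−,
  10–14 files; inner cut (M-a)…(M-d) in the card `F3DualAbelianScheme.md`, WORDS until this stub is itself cut).
* §5 `dualPair_of_isProjective` = [MFK Cor. 6.8] in PRINT form («`A → S` PROJECTIVE abelian scheme, `S` locally noetherian (`ℚ`-scheme)
  ⇒ a dual pair»), PROVED from (L) + (K) + (M) chartwise and (Z); §6 the chart lemma (B-typ01 menu §3, proved); §7 THE HEAD `stub_F3`,
  PROVED from §5 + §6 + (Z) (B-typ01 menu §4 proof, one token renamed).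

`lean check`: sorries = EXACTLY the four `stub_*`; `--axioms …F3DualAbelianScheme.stub_F3` = {propext, Classical.choice, Quot.sound} ⊕ sorryAx.
HOME-only until the director's registration word (s320 (3)/s321 (D2): `ledger crux write stmt-HodgeConjecture-24835 Lines/F3DualAbelianScheme.lean|.md`,
NO `skeleton check`); 0 names booked; imports = 3 ★ modules + HarnessLib, none below the L11 leg.
-/

noncomputable section

open CategoryTheory CategoryTheory.Limits AlgebraicGeometry
open Literature.AlgebraicGeometry.AbelianSchemes Literature.AlgebraicGeometry.Motives
  Literature.AlgebraicGeometry.AbelianVarieties Literature.AlgebraicGeometry.Modules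
open Literature.AlgebraicGeometry.Morphisms (IsProjective)

namespace Summit.HodgeConjecture.CorCM.Cruxes.HypDel.F3DualAbelianScheme

/-! ## §1 (Z) — dual pairs glue along an open cover of the base (B-p06 (g14) census 4119b73a §0; B-typ01 menu §2 verbatim) -/

/-- **stub (Z) `stub_F3Z`** — «`DualPair`s GLUE ALONG A ZARISKI COVER OF THE BASE»: if `A ×_S Uᵢ` has a dual pair for every
member `Uᵢ → S` of an open cover of the locally noetherian base `S`, then `A` has a dual pair (the local duals are uniquely
isomorphic by `DualPair.universal` ⇒ normalised transitions satisfy the cocycle condition for free ⇒ Zariski gluing of `Â`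
and of `𝒫`).  Standard, NOT printed in [MFK 6.8]; road (Z1)(Z2)(Z3) of the census, 3 files ≈ 1 k lines over ★
`DualPair.normalize` / `DualTransport*` / `AbelianSchemeOverGlueData` / `Modules.UnitCocycle`.  Why it might fail: only as typed —
the gluing of the `universal` field needs rigidified isomorphisms to be unique over NON-reduced `T` (★ `RigidifiedAutOfReducedBase` is
stated for reduced bases; census (Z2) re-proves it from ★ `AbelianSchemeSteinOfNoetherian`).
[cite: BoschLutkebohmertRaynaud1990, §8.1 Prop. 4 and proof of Thm. 8.2.1 (the rigidified Picard functor is a Zariski sheaf)]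
[cite: MumfordAV1970, §13 p. 125 (normalised isomorphisms of rigidified bundles are unique, so local data glue)] -/
theorem stub_F3Z : ∀ ⦃S : Scheme.{0}⦄ [IsLocallyNoetherian S] (A : AbelianSchemeOver S) (𝒰 : S.OpenCover),
    (∀ i, (A.baseChange (𝒰.f i)).DualPair) → Nonempty A.DualPair :=
  -- (Z) DISCHARGED BY NAME (ed. 1.5): ★ p797538 `Theorems/F3DualAbelianSchemeStubZ`
  Summit.HodgeConjecture.CorCM.Cruxes.HypDel.F3DualAbelianScheme.stub_F3Z_holds

/-! ## §2 (L) — projective ⇒ affine-locally a rigidified rank-one `L`, fibrewise of the class of an ample divisor -/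

/-- **stub (L) `stub_F3L`** — «A PROJECTIVE ABELIAN SCHEME CARRIES, AFFINE-LOCALLY ON THE BASE, A RIGIDIFIED LINE BUNDLE WHICH IS
FIBREWISE THE CLASS OF AN AMPLE DIVISOR»: for `A → S` projective (★ `Morphisms.IsProjective`: a closed immersion `j : A ↪ ℙ(ι; S)` over
`S`) over a locally noetherian `ℚ`-scheme and `s ∈ S`, there are an affine open `Spec R ↪ S` through `s` (`R` a Noetherian `ℚ`-algebra)
and on `A ×_S Spec R` a rank-one `L` (namely `j^*𝒪(1) ⊗ (π^* ε^* j^*𝒪(1))⁻¹` on a chart where `ε^* j^*𝒪(1)` is trivial) whose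
class restricts to `1` along the unit section and, on every geometric fibre, to the class of an ample Cartier divisor (a hyperplane
section) — literally the hypotheses `(hL, hε, hΘ)` of ★ `AbelianSchemeOver.exists_isClosedImmersion_isFinite_iff_memKOfL_of_isNoetherianRing`.
Why it might fail: only as typed — producing `Θ : CartierDivisor` with `Θ.cechClass =` the pulled-back `detClass` needs a hyperplane of
`ℙ(ι; Ω)` not containing the (integral) fibre and the tree's `CartierDivisor`/`CechPic` comparison for `𝒪(H)`; size S–M (1–2 files).  Ed. 1.2: the chart is moreover CONNECTED (conjunct `ConnectedSpace ↥(Spec (.of R))`) — shrink a Noetherian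
affine open around `s` to the clopen connected component of `s`, a basic open `Spec R_e` (`e` idempotent), again affine; ★ pattern
`Morphisms/FiniteEtaleSurjectiveLift` (`Subtype.connectedSpace isConnected_connectedComponent`, `locallyConnectedSpace_of_isLocallyNoetherian`).
[cite: Hartshorne1977, II §4 Definition p.103 (projective morphism)]
[cite: Hartshorne1977, II §7 p. 157 (divisor of zeros `(s)₀` of a section — here a hyperplane section of the geometric fibre)]
[cite: MumfordAV1970, §6 Application 1 and its proof (pp. 60–61)] -/
theorem stub_F3L : ∀ ⦃S : Scheme.{0}⦄ [IsLocallyNoetherian S] (_fS : S ⟶ Spec (.of ℚ)) (A : AbelianSchemeOver S),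
    IsProjective A.X.hom → ∀ s : S, ∃ (R : Type) (_ : CommRing R) (_ : IsNoetherianRing R) (_ : Algebra ℚ R)
      (_ : ConnectedSpace ↥(Spec (.of R))) (i : Spec (.of R) ⟶ S) (_ : IsOpenImmersion i) (_ : s ∈ Set.range i.base)
      (L : (A.baseChange i).left.Modules) (hL : HasRank L 1),
      CechPic.pullback (A.baseChange i).unitSection (detClass (HasRank.isFiniteLocallyFree' hL)) = 1 ∧
      ∀ ⦃Ω : Type⦄ [Field Ω] [IsAlgClosed Ω] (t : Spec (.of Ω) ⟶ Spec (.of R)),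
        ∃ Θ : CartierDivisor ((A.baseChange i).fibre t).toAbelianVariety.X.left, Θ.IsAmple ∧
          CechPic.pullback (X := ((A.baseChange i).fibre t).toAbelianVariety.X.left) (pullback.fst (A.baseChange i).X.hom t)
            (detClass (HasRank.isFiniteLocallyFree' hL)) = Θ.cechClass :=
  Literature.AlgebraicGeometry.AbelianSchemes.AbelianSchemeOver.exists_affine_rigidified_fibrewise_ample_of_isProjective

/-! ## §3 (K) — `K(L)` is a closed subgroup scheme FINITE ÉTALE over a Noetherian affine `ℚ`-base -/

/-- **stub (K) `stub_F3K`** — «`K(L)` IS FINITE ÉTALE OVER THE BASE» for `L` as in (L) over a Noetherian affine `ℚ`-base `Spec R`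
(`R` arbitrary: neither a domain nor reduced): the closed subscheme `Z ↪ A` representing `K(L) = {x | T_x^* L ≅ L ⊗ p^*(⋯)}`
(★ `MemKOfL`; closed and FINITE over `Spec R` = ★ `exists_isClosedImmersion_isFinite_iff_memKOfL_of_isNoetherianRing`, unconditional)
is moreover ÉTALE over `Spec R`.  Road: over an integral base ★ `exists_kOfL_etale_of_finrank_fibre_eq` reduces étaleness to the
constancy of the fibre rank `|K(L_s̄)|`, which is `χ(L_s̄)² = ((Θ_s̄^g)/g!)²` by Riemann–Roch on the geometric fibres and hence locally
constant (flatness of `A → S`); over a general (non-reduced) Noetherian base add the infinitesimal lifting of points of `K(L)`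
(`dφ_L : Lie A_s̄ → H¹(A_s̄, 𝒪)` is an isomorphism when `K(L_s̄)` is finite and the characteristic is `0`), so that `Z` is flat, and
unramified + flat = étale.  Why it might fail: true in print; as typed the non-reduced case is NOT reachable from the ★ engine
(`[IsDomain R]`) and needs the lifting lemma — the same lemma (M)'s universality needs; size M–L (2–4 files).
[cite: MumfordAV1970, §13 (p. 123) (`K(L)` finite for `L` ample) and §16 (the Riemann–Roch theorem: `χ(L)² = deg φ_L`)]
[cite: GortzWedhorn2023, Prop. 27.187 and Cor. 27.63 (fibre criteria for flat / étale finite morphisms)] -/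
theorem stub_F3K : ∀ (R : Type) [CommRing R] [IsNoetherianRing R] [Algebra ℚ R] (A : AbelianSchemeOver (Spec (.of R)))
    (L : A.left.Modules) (hL : HasRank L 1)
    (_hε : CechPic.pullback A.unitSection (detClass (HasRank.isFiniteLocallyFree' hL)) = 1)
    (_hΘ : ∀ ⦃Ω : Type⦄ [Field Ω] [IsAlgClosed Ω] (s : Spec (.of Ω) ⟶ Spec (.of R)),
      ∃ Θ : CartierDivisor (A.fibre s).toAbelianVariety.X.left, Θ.IsAmple ∧
        CechPic.pullback (X := (A.fibre s).toAbelianVariety.X.left) (pullback.fst A.X.hom s)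
          (detClass (HasRank.isFiniteLocallyFree' hL)) = Θ.cechClass),
    ∃ (Z : Over (Spec (.of R))) (i : Z ⟶ A.X) (_ : IsClosedImmersion i.left) (_ : IsFinite Z.hom) (_ : Etale Z.hom),
      ∀ (T : Over (Spec (.of R))) (u : T ⟶ A.X), (∃ v : T ⟶ Z, v ≫ i = u) ↔ A.MemKOfL L u := by
  intro R _ _ _ A L hL hε hΘ
  exact A.exists_kOfL_etale hL hε hΘ

/-! ## §4 (M) — MUMFORD'S CONSTRUCTION `Â := A ⁄ K(L)` over a Noetherian affine `ℚ`-base — THE HARDEST STUB -/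

/-- **stub (M) `stub_F3M` — THE HARDEST STUB** — «AN ABELIAN SCHEME OVER A NOETHERIAN AFFINE `ℚ`-BASE CARRYING A RIGIDIFIED
FIBREWISE-AMPLE-CLASS `L` WITH `K(L)` FINITE ÉTALE HAS A DUAL PAIR» (ed. 1.1: `A → Spec R` PROJECTIVE, binder `_hA` — every consumer has it:
§5 works on the charts of a projective `A`; ed. 1.2: `Spec R` CONNECTED, binder `[ConnectedSpace]`, delivered by (L)'s charts): [MumfordAV1970] §13 Theorem (p. 125) «`Â = A/K(L)`, the Poincaré
bundle is the descent of `Λ(L) = m^*L ⊗ p₁^*L⁻¹ ⊗ p₂^*L⁻¹` along `1 × π`» run RELATIVE to `Spec R`, delivering exactly the six fields of ★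
`AbelianSchemeOver.DualPair` ([MumfordFogartyKirwan1994] Ch. 6 §1 Cor. 6.8 (p. 118), §2 (p. 121)).  Inner cut (words, card §Stubs (M-a)–(M-d)):
(M-a) étale-locally on `Spec R` the finite étale `K(L)` is CONSTANT (split by a finite étale Galois cover of an affine open);
(M-b) for constant `K` the quotient `A' ⁄ K` is an abelian scheme (★ `AbelianSchemeOver.quotientBy`, ★ `AbelianSchemeConstSubgroupQuotient*`,
stable affine covers ★ `…StableCoverOfQuasiProjective`) and `Λ(L)` (★ `AbelianSchemeOver.mumfordBundle`) descends along `1 × π` to a rank-one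
`𝒫` rigidified along `ε × 1` and fibrewise in `Pic⁰` (★ `AbelianSchemeQuotientPoincare*` pattern; [MumfordAV1970] §8, §12 Thm. 1 (p. 112), §13);
(M-c) UNIVERSALITY of `(A' ⁄ K, 𝒫)` over ALL `T → S'` — the genuinely new content over a base: the seesaw transporter `Z_ℒ ⊂ A'_T` is closed,
the Artinian lifting lemma (`dφ_L` iso in characteristic `0`) makes `Z_ℒ → T` étale surjective, so `φ_Λ : A' → Pic⁰_{rig}` is an
epimorphism of étale sheaves with kernel `K`, and ★ `RigidifiedTrivialFpqcDescent` glues the classifying map ([MumfordAV1970] §13 Theorem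
p. 125; [MumfordFogartyKirwan1994] Ch. 6 §2 p. 121); (M-d) Galois base-quotient descent of the dual pair from `S'` to the affine opens of
`Spec R` (★ `DualPairBaseQuotientDescent.exists_dualPair_fields_of_free_base_quotient` — its `[IsReduced]` hypothesis must be REMOVED — over a
`Γ`-stable affine cover of `Â'` from the norm `N_π(L')`, relatively ample) and Zariski patching by (Z).  Why it might fail: true in print
([MumfordAV1970] §13 over a field, [MumfordFogartyKirwan1994] 6.8 / [FC90] I.1 over a base); as typed the risks are (M-c) over non-reduced
`T` (no ★ carrier for the lifting lemma) and (M-d) (★ descends sheaves/morphisms/sections, not yet OBJECTS: price-sheet LACK (Q2c));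
size L–XL− (10–14 files).
[cite: MumfordAV1970, §13 Theorem (p. 125) (the dual abelian variety `A/K(L)` and its Poincaré bundle) and §12 Thm. 1 (p. 112)]
[cite: MumfordFogartyKirwan1994, Ch. 6 §1 Corollary 6.8 (p. 118) and §2 (p. 121)]
[cite: MilneAV2008, I §8 pp. 36–37 (the dual pair is determined by its universal property)]
[cite: SGA1, Exp. VIII Cor. 7.8 (effective descent of quasi-projective schemes with compatible ample sheaf)] -/
theorem stub_F3M : ∀ (R : Type) [CommRing R] [IsNoetherianRing R] [Algebra ℚ R] [ConnectedSpace ↥(Spec (.of R))]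
    (A : AbelianSchemeOver (Spec (.of R))) (_hA : IsProjective A.X.hom) (L : A.left.Modules) (hL : HasRank L 1)
    (_hε : CechPic.pullback A.unitSection (detClass (HasRank.isFiniteLocallyFree' hL)) = 1)
    (_hΘ : ∀ ⦃Ω : Type⦄ [Field Ω] [IsAlgClosed Ω] (s : Spec (.of Ω) ⟶ Spec (.of R)),
      ∃ Θ : CartierDivisor (A.fibre s).toAbelianVariety.X.left, Θ.IsAmple ∧
        CechPic.pullback (X := (A.fibre s).toAbelianVariety.X.left) (pullback.fst A.X.hom s)
          (detClass (HasRank.isFiniteLocallyFree' hL)) = Θ.cechClass)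
    (_hK : ∃ (Z : Over (Spec (.of R))) (i : Z ⟶ A.X) (_ : IsClosedImmersion i.left) (_ : IsFinite Z.hom) (_ : Etale Z.hom),
      ∀ (T : Over (Spec (.of R))) (u : T ⟶ A.X), (∃ v : T ⟶ Z, v ≫ i = u) ↔ A.MemKOfL L u),
    Nonempty A.DualPair :=
  -- (M) DISCHARGED BY NAME (ed. 1.6): ★ p797770 `Theorems/F3DualAbelianSchemeStubM` (rung T3)
  Summit.HodgeConjecture.CorCM.Cruxes.HypDel.F3DualAbelianScheme.stub_F3M_holds

/-! ## §5 [MFK Cor. 6.8] in PRINT form — PROVED from (L) + (K) + (M) chartwise and (Z) -/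

/-- **[MumfordFogartyKirwan1994, Ch. 6 §1 Corollary 6.8 (p. 118)] in print form, PROVED from the stubs**: a PROJECTIVE abelian scheme
over a locally noetherian `ℚ`-scheme has a dual pair — cover `S` by the affine charts of (L) (a Mathlib `Scheme.Cover.mkOfCovers` indexed
by the points of `S`), on each chart (K) makes `K(L)` finite étale and (M) produces the dual pair of `A ×_S Spec R`, and (Z) glues.
(B-typ01 (g17) menu v0 had this as the monolithic stub `stub_F3P`; projectivity of `Â` is not asserted — no consumer.)
[cite: MumfordFogartyKirwan1994, Ch. 6 §1 Corollary 6.8 (p. 118) and §2 (p. 121)] [cite: MumfordAV1970, §13 Theorem (p. 125)] -/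
theorem dualPair_of_isProjective ⦃S : Scheme.{0}⦄ [IsLocallyNoetherian S] (fS : S ⟶ Spec (.of ℚ)) (A : AbelianSchemeOver S)
    (hA : IsProjective A.X.hom) : Nonempty A.DualPair := by
  classical
  choose R iR iN iQ iC i hi hs L hL h using stub_F3L fS A hA
  let 𝒰 : S.OpenCover :=
    Scheme.Cover.mkOfCovers (P := @IsOpenImmersion) S _ i
      (fun s => ⟨s, (hs s).choose, (hs s).choose_spec⟩) hi
  refine stub_F3Z A 𝒰 fun s => ?_
  exact (@stub_F3M (R s) (iR s) (iN s) (iQ s) (iC s) (A.baseChange (i s))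
    (by rw [AbelianSchemeOver.baseChange_hom]; exact hA.pullback_snd (i s)) (L s) (hL s) (h s).1 (h s).2
    (@stub_F3K (R s) (iR s) (iN s) (iQ s) (A.baseChange (i s)) (L s) (hL s) (h s).1 (h s).2)).some

/-! ## §6 Chart lemma (PROVED; B-typ01 menu §3 verbatim): projectivity of a chart passes to the chosen base change -/

/-- If `G : B → A` over `i : U → S` exhibits `B` as a base change of `A` (★ `AbelianSchemeOver.IsBaseChangeVia`: cartesian
square of group schemes) and `B → U` is projective, then the CHOSEN base change `A.baseChange i → U` (= `pullback.snd`) is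
projective: `pullback.snd = e⁻¹ ≫ (B → U)` for the comparison isomorphism `e : B ≅ A ×_S U` of the cartesian square, and an
isomorphism is a closed immersion. [cite: Hartshorne1977, II §4 Definition p.103 (projective morphism)] -/
theorem isProjective_baseChange_of_isBaseChangeVia {S U : Scheme.{0}} {A : AbelianSchemeOver S} {i : U ⟶ S}
    {B : AbelianSchemeOver U} {G : B.X.left ⟶ A.X.left} (h : B.IsBaseChangeVia A i G) (hB : IsProjective B.X.hom) :
    IsProjective (A.baseChange i).X.hom := by
  obtain ⟨-, hpb, -, -⟩ := h
  have e : pullback.snd A.X.hom i = hpb.isoPullback.inv ≫ B.X.hom :=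
    (Iso.eq_inv_comp _).2 hpb.isoPullback_hom_snd
  rw [AbelianSchemeOver.baseChange_hom, e]
  exact hB.comp_isClosedImmersion _

/-! ## §7 THE HEAD — registry-24835 letter `stub_F3` VERBATIM, PROVED from §5 + §6 + (Z) -/

/-- **HEAD `stub_F3`** = letter (L) «dual pairs Zariski-locally of projective abelian schemes» of registry 24835 v5.5-C
(REF1 digest 343c289e; = ★ capstone binder `hF3` of `exists_threshold_siegelFineModuliScheme_of_cores'`), statement
VERBATIM, here PROVED (B-typ01 (g17) menu §4 proof): index an open cover of `S` by the points of `S` using the charts of the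
hypothesis (Mathlib `Scheme.Cover.mkOfCovers`); on the chart at `s`, `A.baseChange (i s)` is projective (§6), `U s` is locally
noetherian (Mathlib `isLocallyNoetherian_of_isOpenImmersion`), so §5 gives its dual pair; (Z) glues.
[cite: MumfordFogartyKirwan1994, Ch. 6 §1 Corollary 6.8 (p. 118)] [cite: Lan2013PELCompactifications, Thm. 1.3.2.3 (p. 70)] -/
theorem stub_F3 : ∀ ⦃S : Scheme.{0}⦄ [IsLocallyNoetherian S] (_fS : S ⟶ Spec (.of ℚ)) (A : AbelianSchemeOver S),
    (∀ s : S, ∃ (U : Scheme.{0}) (i : U ⟶ S) (_ : IsOpenImmersion i) (_ : s ∈ Set.range i.base)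
      (B : AbelianSchemeOver U) (G : B.X.left ⟶ A.X.left), B.IsBaseChangeVia A i G ∧ IsProjective B.X.hom) →
    Nonempty A.DualPair := by
  intro S _ fS A hL
  choose U i hi hs B G hBG hproj using hL
  let 𝒰 : S.OpenCover :=
    Scheme.Cover.mkOfCovers (P := @IsOpenImmersion) S U i
      (fun s => ⟨s, (hs s).choose, (hs s).choose_spec⟩) hi
  refine stub_F3Z A 𝒰 fun s => ?_
  haveI : IsOpenImmersion (i s) := hi s
  haveI : IsLocallyNoetherian (U s) := isLocallyNoetherian_of_isOpenImmersion (i s)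
  exact (dualPair_of_isProjective (i s ≫ fS) (A.baseChange (i s))
    (isProjective_baseChange_of_isBaseChangeVia (hBG s) (hproj s))).some

end Summit.HodgeConjecture.CorCM.Cruxes.HypDel.F3DualAbelianScheme

end
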